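import Mathlib
import HarnessLib
import Summits.HubbardSuperconductivity.HubbardSuperconductivity.Theses.ComplexGFFStiffness
import Summits.HubbardSuperconductivity.HubbardSuperconductivity.Theorems.ComplexGFFStiffnessHypACumulantStubGnvOfFrd

/-!
# Route `ComplexGFFStiffness`, child `ZNonvanishing` of the crux `HypALocalTwoPoint` — CLOSED (by citation)

The route child `ZNonvanishing` (item `stmt-HubbardSuperconductivity-27384`, conjunct split of the crux
`HypALocalTwoPoint` by the crux-strategist) is by definition
`Summit.HubbardSuperconductivity.HubbardSuperconductivity.Theorems.ComplexGFF.ZNonvanishing`: `N`-uniform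
non-vanishing `Z_{L^N}(g, 0) ≠ 0` of the untilted complex gradient partition function along the tower, for
`0 ≤ g ≤ g₀(L)`, every odd `L ≥ L₀`.  It is ALREADY A THEOREM of the tree:
`Theorems.ComplexGFF.zNonvanishing` (from the landed `gnv : GNV`, [ABKM19] Theorem 2.2, representation
half, transcribed to the `ι`-symmetric complex class; file `…HypACumulantStubGnvOfFrd`).  This file is the
by-name bookkeeping only.

Honest scope: this closes ONE (already proved) conjunct of ONE crux of a rung route (stiffness of a complex
Gaussian gradient field via the [ABKM19] renormalisation group); it does not prove the crux
`HypALocalTwoPoint`, the route, or anything about superconductivity in the Hubbard model.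

## References
* S. Adams, S. Buchholz, R. Kotecký, S. Müller, arXiv:1910.13564, Theorem 2.2 / Ch. 4 / Lemma 12.6
  [AdamsBuchholzKoteckyMuller2019].
-/

-- `Summit.<Summit>.<Problem>`: single-conjunct summit, the duplicate component is mandated (D-0017).
set_option linter.dupNamespace false

namespace Summit.HubbardSuperconductivity.HubbardSuperconductivity.Theorems

/-- **The route child `ZNonvanishing` holds**: it is `Theorems.ComplexGFF.zNonvanishing`
(`N`-uniform `Z_{L^N}(g,0) ≠ 0` from the landed `GNV`). [cite: AdamsBuchholzKoteckyMuller2019, Theorem 2.2] -/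
theorem ZNonvanishing_proof :
    Summit.HubbardSuperconductivity.HubbardSuperconductivity.Theses.ComplexGFFStiffness.ZNonvanishing := by
  unfold Summit.HubbardSuperconductivity.HubbardSuperconductivity.Theses.ComplexGFFStiffness.ZNonvanishing
  exact Summit.HubbardSuperconductivity.HubbardSuperconductivity.Theorems.ComplexGFF.zNonvanishing

end Summit.HubbardSuperconductivity.HubbardSuperconductivity.Theorems
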